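import Summits.AtomisticToContinuum.HydrodynamicLimit.Theses.AntiMazurCoboundaries
import Literature.MathematicalPhysics.KineticTheory.HardSphereEulerProofs
import Summits.AtomisticToContinuum.HydrodynamicLimit.Theorems.BoltzmannGreenKubo.Negative.ForallN

/-!
# The momentum witness `g_M(w) = w₀/(1 + w₀²/100)` and its overlap `m = E γ[g_M w₀] ≥ 1/2` (helper file 5/7)

`g_M` is bounded (`≤ 5`), continuous, odd — hence `γ`-orthogonal to `span(1, |v|²)` (`gM_orth`) — and
`m ≥ 1 − E[w₀⁴]/100 ≥ 1 − 3e²/100 ≥ 1/2` (`half_le_mM`; the fourth-moment bound `E γ₁[x⁴] ≤ 3e²` from `x⁴ ≤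
(3/2)(e^{2x} + e^{−2x})` and the Gaussian mgf).
refuter-cdisprove-stmt-AtomisticToContinuum-13985-0 (crux BoltzmannGreenKubo, stmt-13985; infrastructure of the Mazur-floor refutation `Negative/OrthMomentum.lean`, see `Cruxes/BoltzmannGreenKubo/Disproof.lean` §1d–§1h).
-/

noncomputable section

namespace Summit.AtomisticToContinuum.HydrodynamicLimit.Theorems

open MeasureTheory ProbabilityTheory Filter Topology Set
open Literature.Analysis.FluidPDE Literature.MathematicalPhysics.KineticTheory
open Literature.Analysis.UnboundedOperators
open scoped InnerProductSpace

namespace BoltzmannGreenKuboOrthMomentum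

section MomentumWitness

/-- THE MOMENTUM WITNESS `g_M(w) = w₀ / (1 + w₀²/100)`: bounded, continuous, odd (hence `γ`-orthogonal to `1`
and `|v|²`) but NOT orthogonal to the momentum component `v₀`. [folklore] -/
def gM (w : V3) : ℝ := w 0 * (1 + (w 0) ^ 2 / 100)⁻¹

/-- Unfolding lemma. [folklore] -/
theorem gM_apply (w : V3) : gM w = w 0 * (1 + (w 0) ^ 2 / 100)⁻¹ := rfl

/-- The denominator is positive. [folklore] -/
theorem gM_den_pos (w : V3) : 0 < 1 + (w 0) ^ 2 / 100 := by positivity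

/-- `|g_M| ≤ 5`. [folklore] -/
theorem abs_gM_le (w : V3) : |gM w| ≤ 5 := by
  have hpos := gM_den_pos w
  rw [gM_apply, abs_mul, abs_inv, abs_of_pos hpos, ← div_eq_mul_inv, div_le_iff₀ hpos]
  nlinarith [sq_abs (w 0), sq_nonneg (|w 0| - 10), abs_nonneg (w 0)]

/-- `g_M` is continuous. [folklore] -/
theorem continuous_gM : Continuous gM := by
  have h0 : Continuous fun w : V3 => w 0 := (EuclideanSpace.proj (𝕜 := ℝ) (0 : Fin 3)).continuous
  exact h0.mul ((continuous_const.add ((h0.pow 2).div_const _)).inv₀ fun w => (gM_den_pos w).ne')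

/-- `g_M` is odd. [folklore] -/
theorem gM_neg (w : V3) : gM (-w) = -gM w := by
  have : (-w) 0 = -(w 0) := rfl
  simp only [gM_apply, this, neg_sq]
  ring

/-- `g_M ⊥ span(1, |v|²)` in `L²(γ)` (oddness under `v ↦ -v`). [folklore] -/
theorem gM_orth (c₀ c₂ : ℝ) : ∫ v, gM v * (c₀ + c₂ * ‖v‖ ^ 2) ∂stdGaussian V3 = 0 := by
  refine BoltzmannGreenKuboForallN.integral_stdGaussian_eq_zero_of_odd (LinearIsometryEquiv.neg ℝ) (fun w => ?_)
  simp only [LinearIsometryEquiv.coe_neg, gM_neg, norm_neg]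
  ring

/-- The coordinate marginals of the standard Gaussian on `ℝ³` are standard real Gaussians. [folklore] -/
theorem measurePreserving_coord (k : Fin 3) :
    MeasurePreserving (fun w : V3 => w k) (stdGaussian V3) (gaussianReal 0 1) := by
  have hmk : Measurable fun w : V3 => w k := (EuclideanSpace.proj (𝕜 := ℝ) k).continuous.measurable
  refine ⟨hmk, ?_⟩
  rw [← map_pi_eq_stdGaussian, Measure.map_map hmk (PiLp.continuous_toLp 2 _).measurable]
  have : (fun w : V3 => w k) ∘ (WithLp.toLp 2) = fun x : Fin 3 → ℝ => x k := by
    funext x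
    simp
  rw [this]
  exact (measurePreserving_eval (fun _ : Fin 3 => gaussianReal 0 1) k).map_eq

/-- `y⁴ ≤ (3/2)(e^{2y} + e^{-2y})` (from `u⁴/4! ≤ eᵘ`, `u = 2|y|`). [folklore] -/
theorem pow_four_le_exp (y : ℝ) : y ^ 4 ≤ 3 / 2 * (Real.exp (2 * y) + Real.exp (-2 * y)) := by
  have h1 : (2 * |y|) ^ 4 / (Nat.factorial 4 : ℕ) ≤ Real.exp (2 * |y|) :=
    Real.pow_div_factorial_le_exp (2 * |y|) (by positivity) 4
  have h2 : Real.exp (2 * |y|) ≤ Real.exp (2 * y) + Real.exp (-2 * y) := by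
    rcases le_or_gt 0 y with hy | hy
    · rw [abs_of_nonneg hy]
      linarith [Real.exp_pos (-2 * y)]
    · rw [abs_of_neg hy, show 2 * -y = -2 * y by ring]
      linarith [Real.exp_pos (2 * y)]
  have h3 : (2 * |y|) ^ 4 = 16 * y ^ 4 := by
    have : |y| ^ 4 = y ^ 4 := by
      rw [show (4 : ℕ) = 2 * 2 from rfl, pow_mul, sq_abs, ← pow_mul]
    rw [mul_pow, this]
    norm_num
  have h4 : ((Nat.factorial 4 : ℕ) : ℝ) = 24 := by norm_num [Nat.factorial]
  rw [h3, h4] at h1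
  linarith

/-- Gaussian moment generating function values. [folklore] -/
theorem integral_exp_mul_gaussianReal (t : ℝ) :
    ∫ x, Real.exp (t * x) ∂gaussianReal 0 1 = Real.exp (t ^ 2 / 2) := by
  have h := congrFun (mgf_id_gaussianReal (μ := 0) (v := 1)) t
  simp only [mgf, id] at h
  rw [h]
  simp

/-- Fourth moment bound `E γ₁[x⁴] ≤ 3e²` (the exact value `3` is not needed). [folklore] -/
theorem integral_pow_four_gaussianReal_le : ∫ x, x ^ 4 ∂gaussianReal 0 1 ≤ 3 * Real.exp 2 := by
  have hint4 : Integrable (fun x : ℝ => x ^ 4) (gaussianReal 0 1) := by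
    have h := (memLp_id_gaussianReal' (μ := 0) (v := 1) 4 (by simp)).integrable_norm_pow (by norm_num)
    refine h.congr (Eventually.of_forall fun x => ?_)
    simp only [id, Real.norm_eq_abs]
    rw [show (4 : ℕ) = 2 * 2 from rfl, pow_mul, sq_abs, ← pow_mul]
  have hexp : ∀ t : ℝ, Integrable (fun x => Real.exp (t * x)) (gaussianReal 0 1) := fun t =>
    integrable_exp_mul_gaussianReal t
  have hrhs : Integrable (fun x => 3 / 2 * (Real.exp (2 * x) + Real.exp (-2 * x))) (gaussianReal 0 1) :=
    ((hexp 2).add (hexp (-2))).const_mul _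
  calc ∫ x, x ^ 4 ∂gaussianReal 0 1
      ≤ ∫ x, 3 / 2 * (Real.exp (2 * x) + Real.exp (-2 * x)) ∂gaussianReal 0 1 :=
        integral_mono hint4 hrhs fun x => pow_four_le_exp x
    _ = 3 / 2 * (Real.exp 2 + Real.exp 2) := by
        rw [integral_const_mul, integral_add (hexp 2) (hexp (-2)), integral_exp_mul_gaussianReal,
          integral_exp_mul_gaussianReal]
        norm_num
    _ = 3 * Real.exp 2 := by ring

/-- `E γ[(w₀)⁴] ≤ 3e²` on `ℝ³`. [folklore] -/
theorem integral_coord_pow_four_le : ∫ w, (w 0) ^ 4 ∂stdGaussian V3 ≤ 3 * Real.exp 2 := by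
  have h := measurePreserving_coord 0
  calc ∫ w, (w 0) ^ 4 ∂stdGaussian V3
      = ∫ x, x ^ 4 ∂((stdGaussian V3).map fun w : V3 => w 0) :=
        (integral_map h.measurable.aemeasurable (continuous_pow 4).aestronglyMeasurable).symm
    _ = ∫ x, x ^ 4 ∂gaussianReal 0 1 := by rw [h.map_eq]
    _ ≤ 3 * Real.exp 2 := integral_pow_four_gaussianReal_le

/-- `(w₀)⁴` is `γ`-integrable. [folklore] -/
theorem integrable_coord_pow_four : Integrable (fun w : V3 => (w 0) ^ 4) (stdGaussian V3) := by
  have h := measurePreserving_coord 0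
  have hint4 : Integrable (fun x : ℝ => x ^ 4) (gaussianReal 0 1) := by
    have h' := (memLp_id_gaussianReal' (μ := 0) (v := 1) 4 (by simp)).integrable_norm_pow (by norm_num)
    refine h'.congr (Eventually.of_forall fun x => ?_)
    simp only [id, Real.norm_eq_abs]
    rw [show (4 : ℕ) = 2 * 2 from rfl, pow_mul, sq_abs, ← pow_mul]
  exact (h.integrable_comp (continuous_pow 4).aestronglyMeasurable).2 hint4

/-- The coordinate `w₀` is `γ`-integrable. [folklore] -/
theorem integrable_coord : Integrable (fun w : V3 => w 0) (stdGaussian V3) :=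
  (memLp_coord_stdGaussian (0 : Fin 3) 1 (by simp)).integrable le_rfl

/-- `(w₀)²` is `γ`-integrable. [folklore] -/
theorem integrable_coord_sq : Integrable (fun w : V3 => (w 0) ^ 2) (stdGaussian V3) :=
  (memLp_coord_stdGaussian (0 : Fin 3) 2 (by simp)).integrable_sq

/-- The momentum overlap `m = E γ[g_M(w) w₀]`. [folklore] -/
def mM : ℝ := ∫ w, gM w * w 0 ∂stdGaussian V3

/-- Pointwise: `g_M(w) w₀ ≥ w₀² − w₀⁴/100`. [folklore] -/
theorem gM_mul_coord_ge (w : V3) : (w 0) ^ 2 - (w 0) ^ 4 / 100 ≤ gM w * w 0 := by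
  have hpos := gM_den_pos w
  rw [gM_apply, show w 0 * (1 + w 0 ^ 2 / 100)⁻¹ * w 0 = (w 0) ^ 2 / (1 + w 0 ^ 2 / 100) by
    rw [div_eq_mul_inv]; ring, le_div_iff₀ hpos]
  nlinarith [sq_nonneg (w 0), sq_nonneg ((w 0) ^ 3), sq_nonneg ((w 0) ^ 2)]

/-- `g_M · w₀` is `γ`-integrable. [folklore] -/
theorem integrable_gM_mul_coord : Integrable (fun w : V3 => gM w * w 0) (stdGaussian V3) :=
  integrable_coord.bdd_mul continuous_gM.aestronglyMeasurable
    (Eventually.of_forall fun w => by rw [Real.norm_eq_abs]; exact abs_gM_le w)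

/-- **The overlap is at least `1/2`** (`E[w₀²] = 1`, `E[w₀⁴] ≤ 3e² < 27`). [folklore] -/
theorem half_le_mM : 1 / 2 ≤ mM := by
  have hlhs : Integrable (fun w : V3 => (w 0) ^ 2 - (w 0) ^ 4 / 100) (stdGaussian V3) :=
    integrable_coord_sq.sub (integrable_coord_pow_four.div_const _)
  have h1 : ∫ w, (w 0) ^ 2 - (w 0) ^ 4 / 100 ∂stdGaussian V3 ≤ mM :=
    integral_mono hlhs integrable_gM_mul_coord gM_mul_coord_ge
  have h2 : ∫ w, (w 0) ^ 2 - (w 0) ^ 4 / 100 ∂stdGaussian V3 =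
      1 - (∫ w, (w 0) ^ 4 ∂stdGaussian V3) / 100 := by
    rw [integral_sub integrable_coord_sq (integrable_coord_pow_four.div_const _), integral_div,
      integral_coord_sq_stdGaussian]
  have h3 := integral_coord_pow_four_le
  have he : Real.exp 2 < 9 := by
    have h1e := Real.exp_one_lt_three
    have : Real.exp 2 = Real.exp 1 * Real.exp 1 := by rw [← Real.exp_add]; norm_num
    rw [this]
    nlinarith [Real.exp_pos 1]
  linarith

/-- `m > 0`. [folklore] -/
theorem mM_pos : 0 < mM := lt_of_lt_of_le (by norm_num) half_le_mM

end MomentumWitness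

end BoltzmannGreenKuboOrthMomentum

end Summit.AtomisticToContinuum.HydrodynamicLimit.Theorems

end
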